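import Mathlib.Analysis.MellinInversion
import Mathlib.Analysis.SpecialFunctions.Gamma.Deriv
import Mathlib.Analysis.SpecialFunctions.Gamma.BohrMollerup
import Mathlib.Analysis.Complex.RemovableSingularity
import Mathlib.Analysis.Complex.CauchyIntegral
import Mathlib.Analysis.SpecialFunctions.JapaneseBracket
import Mathlib.MeasureTheory.Integral.IntegralEqImproper
import Literature.NumberTheory.LFunctions.RHZetaGrowthProofs
import Literature.NumberTheory.LFunctions.RiemannXiOrderProofs
import Literature.NumberTheory.LFunctions.MertensBoundRH
import HarnessLib

/-!
# Mellin–Barnes approximation of `1/ζ` by smoothed Möbius sums under RH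

Topic: `Literature/NumberTheory/LFunctions`. Under the Riemann hypothesis, for `0 < κ ≤ 1/2`,
`σ₀ > 1/2`, `X ≥ 1` and `re s ≥ σ₀ + κ`,

  `‖∑_{a ≥ 1} μ(a) e^{-a/X} a^{-s} - 1/ζ(s)‖ ≤ K X^{-κ} (1 + |im s|)^{1/8}`

(`norm_LSeries_smoothedMoebius_sub_zetaInv_le`), a smoothed substitute for the sharp
partial-sum estimate `∑_{a≤n} μ(a)a^{-s} = 1/ζ(s) + O(n^{-δ/3}(1+|τ|)^ε)` of Balazard–Saias
(*Notes 1*, Lemme 2) = Báez-Duarte (2003), Lemma 2.1, which is what Báez-Duarte's proof of the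
Nyman–Beurling criterion for natural dilations actually needs (see
`Literature/NumberTheory/LFunctions/NymanBeurlingProofs.lean`, `Literature.NumberTheory.LFunctions.InvZetaDirichletApprox`, and
`Literature/NumberTheory/LFunctions/NymanBeurlingBaezDuarteProofs.lean` for the deduction).

## The argument (Titchmarsh §14.25 with a smooth cutoff)

With `G_{s,X}(z) = Γ(z) X^z (zetaInv(s+z) - zetaInv(s))` — holomorphic on `-1 < re z`,
`re(s+z) > 1/2` under RH, the simple pole of `Γ` at `0` being cancelled (`mbIntegrand`, written
with `Γ(z+1)` and a difference quotient), where `zetaInv = 1/ζ` continued through the pole of `ζ`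
by `zetaInv 1 = 0` —, Cauchy's theorem on the rectangles `[-κ, 2] × [-Y, Y]` and `Y → ∞` give
`∫ G_{s,X}(2+iy) dy = ∫ G_{s,X}(-κ+iy) dy` (the tree's
`Literature.NumberTheory.LFunctions.MertensBoundRH.integral_vertical_eq_of_tendsto`; the horizontal sides are `O(Y^{-2})` by
`Γ(w) = Γ(w+3)/(w(w+1)(w+2))`, `|Γ(w+3)| ≤ 24`). On `re z = 2` the
Mellin–Barnes formula `e^{-x} = (2π)⁻¹∫ Γ(2+iy) x^{-2-iy} dy` (Mathlib's Mellin inversion,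
`mellinInv_Gamma_two`) and `1/ζ(w) = ∑ μ(a)a^{-w}` (`re w > 1`) evaluate the integral as
`2π ∑ μ(a)e^{-a/X}a^{-s} - 2π e^{-1/X} zetaInv(s)` (`integral_mbIntegrand_two`, `∫∑ = ∑∫`); on
`re z = -κ`, Littlewood's `1/ζ(w) = O((1+|im w|)^{1/8})` for `re w ≥ σ₀` (Titchmarsh (14.2.6),
`Literature/NumberTheory/LFunctions/RHZetaGrowthProofs.lean`) and `|Γ(-κ+iy)| ≪ κ⁻¹(1+|y|)^{-2}`
bound it by `O(X^{-κ}(1+|im s|)^{1/8})`. Finally `1 - e^{-1/X} ≤ X^{-κ}`.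

## Main definitions and results (all proved)

* (`1/ζ` continued through the pole is the tree's `Literature.NumberTheory.LFunctions.MertensBoundRH.zetaInv`; here
  `exists_norm_zetaInv_le`, `zetaInv_eq_LSeries`.)
* `Literature.NumberTheory.LFunctions.MellinBarnes.mbIntegrand`, `Literature.NumberTheory.LFunctions.MellinBarnes.smoothedMoebius`, `Literature.NumberTheory.LFunctions.MellinBarnes.mbCoeff` (defs).
* `Literature.NumberTheory.LFunctions.MellinBarnes.mellinInv_Gamma_two` — `e^{-x} = (2π)⁻¹ ∫ Γ(2+iy)x^{-(2+iy)}dy`.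
* `Literature.NumberTheory.LFunctions.MellinBarnes.integral_mbIntegrand_two` — evaluation on `re z = 2`.
* `Literature.NumberTheory.LFunctions.MellinBarnes.norm_LSeries_smoothedMoebius_sub_zetaInv_le` — the main estimate.
* `Literature.NumberTheory.LFunctions.MellinBarnes.norm_LSeries_sub_sum_le`, `tendsto_tail_exp` — truncation of the smoothed sum;
  `Literature.NumberTheory.LFunctions.MellinBarnes.sum_mbCoeff_mul_cpow` — the coefficients `mbCoeff` give the truncated sum.

## References

* E. C. Titchmarsh, *The Theory of the Riemann Zeta-Function*, 2nd ed. (1986), §14.2 (14.2.6)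
  and §14.25 (Perron-type treatment of `∑ μ(n)n^{-s}` under RH).
* L. Báez-Duarte, *A strengthening of the Nyman–Beurling criterion for the Riemann hypothesis*,
  Atti Accad. Naz. Lincei (9) 14 (2003), 5–11, Lemma 2.1 and §2.2.
* M. Balazard, E. Saias, *Notes sur la fonction ζ de Riemann, 1*, Adv. Math. 139 (1998), Lemme 2.
-/

noncomputable section

open Complex Filter Topology Set MeasureTheory Asymptotics
open scoped Real

namespace Literature.NumberTheory.LFunctions

namespace MellinBarnes

open MertensBoundRH (zetaInv zetaInv_of_ne_one)

/-! ## Bounds for `Γ` in the strip `-1 ≤ re w ≤ 2` -/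

/-! `‖Γ(s)‖ ≤ Γ(re s)` for `re s > 0` is the tree's `Literature.NumberTheory.LFunctions.norm_Gamma_le_Gamma_re`
(`Literature/NumberTheory/LFunctions/RiemannXiOrderProofs.lean`). -/

/-- `Γ(x) ≤ 24` for `2 ≤ x ≤ 5` (`Γ` increases on `[2,∞)`, `Γ(5) = 24`). [folklore] -/
lemma real_Gamma_le_of_mem {x : ℝ} (h2 : 2 ≤ x) (h5 : x ≤ 5) : Real.Gamma x ≤ 24 := by
  have hmono := Real.Gamma_strictMonoOn_Ici.monotoneOn
  have h : Real.Gamma x ≤ Real.Gamma 5 :=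
    hmono (Set.mem_Ici.2 h2) (Set.mem_Ici.2 (by norm_num)) h5
  have h5' : Real.Gamma 5 = 24 := by
    rw [show (5 : ℝ) = (4 : ℕ) + 1 by norm_num, Real.Gamma_nat_eq_factorial]
    norm_num [Nat.factorial]
  linarith

/-- **Three-step recurrence bound**: for `-1 ≤ re w ≤ 2`, `w ≠ 0`, `w ≠ -1`,
`‖Γ(w)‖ ≤ 24/(‖w‖ ‖w+1‖ ‖w+2‖)` (`Γ(w) = Γ(w+3)/(w(w+1)(w+2))`, `|Γ(w+3)| ≤ Γ(re w+3) ≤ 24`).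
[folklore] -/
lemma norm_Gamma_le_of_re_mem {w : ℂ} (h1 : -1 ≤ w.re) (h2 : w.re ≤ 2) (hw0 : w ≠ 0)
    (hw1 : w + 1 ≠ 0) : ‖Complex.Gamma w‖ ≤ 24 / (‖w‖ * ‖w + 1‖ * ‖w + 2‖) := by
  have hw2 : w + 2 ≠ 0 := by
    intro h; have := congrArg Complex.re h; simp at this; linarith
  have e1 : Complex.Gamma (w + 1) = w * Complex.Gamma w := Complex.Gamma_add_one w hw0
  have e2 : Complex.Gamma (w + 2) = (w + 1) * Complex.Gamma (w + 1) := by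
    rw [show w + 2 = w + 1 + 1 by ring]; exact Complex.Gamma_add_one _ hw1
  have e3 : Complex.Gamma (w + 3) = (w + 2) * Complex.Gamma (w + 2) := by
    rw [show w + 3 = w + 2 + 1 by ring]; exact Complex.Gamma_add_one _ hw2
  have hG3 : ‖Complex.Gamma (w + 3)‖ ≤ 24 :=
    (Literature.NumberTheory.LFunctions.norm_Gamma_le_Gamma_re (by simp; linarith)).trans
      (real_Gamma_le_of_mem (by simp; linarith) (by simp; linarith))
  have h : Complex.Gamma w = Complex.Gamma (w + 3) / (w * (w + 1) * (w + 2)) := by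
    rw [e3, e2, e1]; field_simp
  rw [h, norm_div, norm_mul, norm_mul]
  exact div_le_div_of_nonneg_right hG3 (by positivity)

/-- `Γ` on the line `re w = -κ`, `0 < κ ≤ 1/2`: `‖Γ(-κ+iy)‖ ≤ (192/κ)(1+|y|)^{-2}`. [folklore] -/
lemma norm_Gamma_neg_line_le {κ : ℝ} (hκ : 0 < κ) (hκ2 : κ ≤ 1 / 2) (y : ℝ) :
    ‖Complex.Gamma (-κ + y * I)‖ ≤ 192 / κ * (1 + |y|) ^ (-2 : ℝ) := by
  set w : ℂ := -κ + y * I with hw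
  have hre : w.re = -κ := by simp [hw]
  have him : w.im = y := by simp [hw]
  have hw0 : w ≠ 0 := by intro h; have := congrArg Complex.re h; rw [hre] at this; simp at this; linarith
  have hw1 : w + 1 ≠ 0 := by intro h; have := congrArg Complex.re h; simp [hw] at this; linarith
  have h := norm_Gamma_le_of_re_mem (by rw [hre]; linarith) (by rw [hre]; linarith) hw0 hw1
  -- lower bounds for the three norms
  have n0 : κ * (1 + |y|) / 2 ≤ ‖w‖ := by
    have a1 : κ ≤ ‖w‖ := by simpa [hre, abs_of_pos hκ] using abs_re_le_norm w
    have a2 : |y| ≤ ‖w‖ := by simpa [him] using abs_im_le_norm w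
    nlinarith [abs_nonneg y]
  have n1 : (1 + |y|) / 4 ≤ ‖w + 1‖ := by
    have a1 : 1 - κ ≤ ‖w + 1‖ := by
      have := abs_re_le_norm (w + 1)
      simp [hw] at this
      rw [abs_of_pos (by linarith)] at this
      rw [hw]; linarith
    have a2 : |y| ≤ ‖w + 1‖ := by simpa [hw] using abs_im_le_norm (w + 1)
    nlinarith [abs_nonneg y]
  have n2 : 1 ≤ ‖w + 2‖ := by
    have := abs_re_le_norm (w + 2)
    simp [hw] at this
    rw [abs_of_pos (by linarith)] at this
    linarith
  have hy1 : 0 < 1 + |y| := by positivity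
  have hprod : κ * (1 + |y|) ^ 2 / 8 ≤ ‖w‖ * ‖w + 1‖ * ‖w + 2‖ := by
    have := mul_le_mul (mul_le_mul n0 n1 (by positivity) (norm_nonneg _)) n2 zero_le_one
      (by positivity)
    calc κ * (1 + |y|) ^ 2 / 8 = κ * (1 + |y|) / 2 * ((1 + |y|) / 4) * 1 := by ring
      _ ≤ _ := this
  have hpos : 0 < κ * (1 + |y|) ^ 2 / 8 := by positivity
  calc ‖Complex.Gamma w‖ ≤ 24 / (‖w‖ * ‖w + 1‖ * ‖w + 2‖) := h
    _ ≤ 24 / (κ * (1 + |y|) ^ 2 / 8) := div_le_div_of_nonneg_left (by norm_num) hpos hprod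
    _ = 192 / κ * (1 + |y|) ^ (-2 : ℝ) := by
        rw [Real.rpow_neg hy1.le, Real.rpow_two]; field_simp; ring

/-- `Γ` on the line `re w = 2`: `‖Γ(2+iy)‖ ≤ 96 (1+|y|)^{-2}`. [folklore] -/
lemma norm_Gamma_two_line_le (y : ℝ) :
    ‖Complex.Gamma (2 + y * I)‖ ≤ 96 * (1 + |y|) ^ (-2 : ℝ) := by
  set w : ℂ := 2 + y * I with hw
  have hw0 : w ≠ 0 := by intro h; have := congrArg Complex.re h; simp [hw] at this
  have hw1 : w + 1 ≠ 0 := by intro h; have := congrArg Complex.re h; simp [hw] at this; linarith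
  have h := norm_Gamma_le_of_re_mem (w := w) (by norm_num [hw]) (by simp [hw]) hw0 hw1
  have n0 : (1 + |y|) / 2 ≤ ‖w‖ := by
    have a1 : 2 ≤ ‖w‖ := by simpa [hw] using abs_re_le_norm w
    have a2 : |y| ≤ ‖w‖ := by simpa [hw] using abs_im_le_norm w
    linarith
  have n1 : (1 + |y|) / 2 ≤ ‖w + 1‖ := by
    have a1 : 3 ≤ ‖w + 1‖ := by
      have := abs_re_le_norm (w + 1); simp [hw] at this; norm_num at this; linarith
    have a2 : |y| ≤ ‖w + 1‖ := by simpa [hw] using abs_im_le_norm (w + 1)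
    linarith
  have n2 : 1 ≤ ‖w + 2‖ := by
    have := abs_re_le_norm (w + 2); simp [hw] at this; norm_num at this; linarith
  have hy1 : 0 < 1 + |y| := by positivity
  have hprod : (1 + |y|) ^ 2 / 4 ≤ ‖w‖ * ‖w + 1‖ * ‖w + 2‖ := by
    have := mul_le_mul (mul_le_mul n0 n1 (by positivity) (norm_nonneg _)) n2 zero_le_one
      (by positivity)
    calc (1 + |y|) ^ 2 / 4 = (1 + |y|) / 2 * ((1 + |y|) / 2) * 1 := by ring
      _ ≤ _ := this
  calc ‖Complex.Gamma w‖ ≤ 24 / (‖w‖ * ‖w + 1‖ * ‖w + 2‖) := h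
    _ ≤ 24 / ((1 + |y|) ^ 2 / 4) := div_le_div_of_nonneg_left (by norm_num) (by positivity) hprod
    _ = 96 * (1 + |y|) ^ (-2 : ℝ) := by
        rw [Real.rpow_neg hy1.le, Real.rpow_two]; field_simp; ring

/-- `Γ` on horizontal segments: for `-1/2 ≤ x ≤ 2`, `|Y| ≥ 1`, `‖Γ(x+iY)‖ ≤ 24/|Y|³`. [folklore] -/
lemma norm_Gamma_horiz_le {x Y : ℝ} (hx1 : -1 / 2 ≤ x) (hx2 : x ≤ 2) (hY : 1 ≤ |Y|) :
    ‖Complex.Gamma (x + Y * I)‖ ≤ 24 / |Y| ^ 3 := by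
  set w : ℂ := x + Y * I with hw
  have hY0 : 0 < |Y| := by linarith
  have him : ∀ k : ℂ, k.im = 0 → |Y| ≤ ‖w + k‖ := fun k hk ↦ by
    have := abs_im_le_norm (w + k); simp [hw, hk] at this; exact this
  have hw0 : w ≠ 0 := by
    intro h; have := him 0 (by simp); rw [add_zero, h, norm_zero] at this; linarith
  have hw1 : w + 1 ≠ 0 := by
    intro h; have := him 1 (by simp); rw [h, norm_zero] at this; linarith
  have h := norm_Gamma_le_of_re_mem (w := w) (by simp [hw]; linarith) (by simp [hw]; linarith)
    hw0 hw1
  have hprod : |Y| ^ 3 ≤ ‖w‖ * ‖w + 1‖ * ‖w + 2‖ := by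
    have a0 := him 0 (by simp); rw [add_zero] at a0
    have a1 := him 1 (by simp)
    have a2 := him 2 (by simp)
    calc |Y| ^ 3 = |Y| * |Y| * |Y| := by ring
      _ ≤ ‖w‖ * ‖w + 1‖ * ‖w + 2‖ :=
        mul_le_mul (mul_le_mul a0 a1 hY0.le (norm_nonneg _)) a2 hY0.le (by positivity)
  exact h.trans (div_le_div_of_nonneg_left (by norm_num) (by positivity) hprod)

/-- `Γ` is continuous on vertical lines `re w = σ` with `σ ∉ -ℕ`. [folklore] -/
lemma continuous_Gamma_line {σ : ℝ} (hσ : ∀ m : ℕ, σ ≠ -m) :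
    Continuous fun y : ℝ ↦ Complex.Gamma (σ + y * I) := by
  refine continuous_iff_continuousAt.2 fun y ↦ ?_
  have hd := Complex.differentiableAt_Gamma (σ + y * I) (fun m h ↦ hσ m ?_)
  · have hc : Continuous fun y : ℝ ↦ (σ : ℂ) + y * I := by fun_prop
    exact ContinuousAt.comp (f := fun y : ℝ ↦ (σ : ℂ) + y * I) hd.continuousAt hc.continuousAt
  · have := congrArg Complex.re h; simpa using this

/-! The integrable majorants `(1+|y|)^{-r}`, `r > 1`, are Mathlib's `integrable_one_add_norm`
(also recorded as `Literature.NumberTheory.LFunctions.BaezDuarteOnlyIf.integrable_one_add_abs_rpow_neg` in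
`NymanBeurlingProofs.lean`); we use `integrable_one_add_norm` directly. -/

/-- `y ↦ Γ(-κ+iy)` is integrable (`0 < κ ≤ 1/2`), with the weight `(1+|y|)^{1/8}` too. [folklore] -/
lemma integrable_Gamma_neg_line_rpow {κ : ℝ} (hκ : 0 < κ) (hκ2 : κ ≤ 1 / 2) :
    Integrable fun y : ℝ ↦ ‖Complex.Gamma (-κ + y * I)‖ * (1 + |y|) ^ (1 / 8 : ℝ) := by
  have hc : Continuous fun y : ℝ ↦ Complex.Gamma (-κ + y * I) := by
    have := continuous_Gamma_line (σ := -κ) (fun m h ↦ by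
      have : (m : ℝ) = κ := by linarith
      have hm : (0 : ℝ) ≤ m := m.cast_nonneg
      rcases Nat.eq_zero_or_pos m with h0 | h0
      · subst h0; simp at this; linarith
      · have : (1 : ℝ) ≤ m := by exact_mod_cast h0
        linarith)
    simpa using this
  have hw8 : Continuous fun y : ℝ ↦ (1 + |y|) ^ (1 / 8 : ℝ) :=
    (continuous_const.add continuous_abs).rpow_const fun _ ↦ Or.inr (by norm_num)
  have hI : Integrable fun τ : ℝ ↦ (1 + |τ|) ^ (-(15 / 8) : ℝ) := by
    simpa [Real.norm_eq_abs] using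
      integrable_one_add_norm (E := ℝ) (μ := volume) (r := 15 / 8) (by simp; norm_num)
  refine (hI.const_mul (192 / κ)).mono'
    ((hc.norm.mul hw8).aestronglyMeasurable) (Eventually.of_forall fun y ↦ ?_)
  have hy : 0 < 1 + |y| := by positivity
  rw [Real.norm_eq_abs, abs_of_nonneg (by positivity)]
  calc ‖Complex.Gamma (-κ + y * I)‖ * (1 + |y|) ^ (1 / 8 : ℝ)
      ≤ 192 / κ * (1 + |y|) ^ (-2 : ℝ) * (1 + |y|) ^ (1 / 8 : ℝ) :=
        mul_le_mul_of_nonneg_right (norm_Gamma_neg_line_le hκ hκ2 y) (by positivity)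
    _ = 192 / κ * (1 + |y|) ^ (-(15 / 8) : ℝ) := by
        rw [mul_assoc, ← Real.rpow_add hy]; norm_num

/-- `y ↦ Γ(2+iy)` is integrable. [folklore] -/
lemma integrable_Gamma_two_line : Integrable fun y : ℝ ↦ Complex.Gamma (2 + y * I) := by
  have hc : Continuous fun y : ℝ ↦ Complex.Gamma (2 + y * I) := by
    have := continuous_Gamma_line (σ := 2) (fun m h ↦ by
      have hm : (0 : ℝ) ≤ m := m.cast_nonneg; linarith)
    simpa using this
  have hI : Integrable fun τ : ℝ ↦ (1 + |τ|) ^ (-(2 : ℝ)) := by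
    simpa [Real.norm_eq_abs] using
      integrable_one_add_norm (E := ℝ) (μ := volume) (r := 2) (by simp)
  refine (hI.const_mul 96).mono'
    hc.aestronglyMeasurable (Eventually.of_forall fun y ↦ ?_)
  exact norm_Gamma_two_line_le y

/-! ## Mellin–Barnes: `e^{-x} = (2π)⁻¹ ∫ Γ(2+iy) x^{-(2+iy)} dy` -/

/-- **Mellin inversion for `e^{-x}` at abscissa `2`**: `(2π)⁻¹ ∫ Γ(2+iy) x^{-(2+iy)} dy = e^{-x}`
for `x > 0` (Mathlib `mellinInv_mellin_eq` with `mellin (e^{-·}) = Γ`). [folklore] -/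
theorem mellinInv_Gamma_two {x : ℝ} (hx : 0 < x) :
    mellinInv 2 Complex.Gamma x = (Real.exp (-x) : ℂ) := by
  set f : ℝ → ℂ := fun t ↦ (Real.exp (-t) : ℂ) with hf
  have hmel : mellin f = Complex.GammaIntegral := Complex.GammaIntegral_eq_mellin.symm
  have hline : ∀ y : ℝ, mellin f (((2 : ℝ) : ℂ) + y * I) = Complex.Gamma (((2 : ℝ) : ℂ) + y * I) := by
    intro y
    rw [hmel, ← Complex.Gamma_eq_integral (by simp)]
  have h1 : mellinInv 2 Complex.Gamma x = mellinInv 2 (mellin f) x := by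
    unfold mellinInv
    congr 1
    refine integral_congr_ae (Eventually.of_forall fun y ↦ ?_)
    simp only
    rw [hline]
  rw [h1]
  refine mellinInv_mellin_eq 2 f hx ?_ ?_ (by fun_prop)
  · -- `MellinConvergent f 2`
    have h := Complex.GammaIntegral_convergent (s := 2) (by simp)
    refine (h.congr_fun (fun t _ ↦ ?_) measurableSet_Ioi)
    simp [hf, smul_eq_mul, mul_comm]
  · -- `VerticalIntegrable (mellin f) 2`
    unfold Complex.VerticalIntegrable
    have := integrable_Gamma_two_line
    refine this.congr (Eventually.of_forall fun y ↦ ?_)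
    have := hline y
    push_cast at this ⊢
    exact this.symm

/-! Moving the line of integration across the pole-free strip `-κ ≤ re z ≤ 2` is the tree's
`Literature.NumberTheory.LFunctions.MertensBoundRH.integral_vertical_eq_of_tendsto` (Cauchy on rectangles, `Y → ∞`); its
uniform horizontal-decay hypothesis is supplied below by `norm_mbIntegrand_horiz_le`. -/

/-! ## `1/ζ` continued through the pole of `ζ`

We use the tree's `Literature.MertensBoundRH.zetaInv = Function.update ζ⁻¹ 1 0`
(`Literature/NumberTheory/LFunctions/MertensBoundRH.lean`): holomorphic on `re > 1/2` under RH
(`MertensBoundRH.differentiableOn_zetaInv`), bounded by `K(1+|t|)^ε` on `re s ≥ σ₀ > 1/2`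
(`MertensBoundRH.exists_bound_zetaInv`, Titchmarsh (14.2.6)). -/

/-- **The (14.2.6) bound for `zetaInv`**, in the form used below: under RH, for `σ₀ > 1/2`,
`δ > 0`: `‖zetaInv w‖ ≤ C (1+|im w|)^δ` for `re w ≥ σ₀` (`MertensBoundRH.exists_bound_zetaInv`).
[cite: Titchmarsh1986, Thm 14.2, eq. (14.2.6)] -/
theorem exists_norm_zetaInv_le (hRH : RiemannHypothesis) {σ₀ : ℝ} (hσ₀ : 1 / 2 < σ₀) {δ : ℝ}
    (hδ : 0 < δ) : ∃ C : ℝ, 0 < C ∧ ∀ w : ℂ, σ₀ ≤ w.re → ‖zetaInv w‖ ≤ C * (1 + |w.im|) ^ δ := by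
  obtain ⟨C, hC, h⟩ := MertensBoundRH.exists_bound_zetaInv hRH hσ₀ hδ
  refine ⟨C, hC, fun w hw ↦ ?_⟩
  have := h w.re w.im hw
  rwa [Complex.re_add_im] at this

/-- `zetaInv w = ∑ μ(n) n^{-w}` for `re w > 1` (`MertensBoundRH.inv_riemannZeta_eq_LSeries`).
[folklore] -/
theorem zetaInv_eq_LSeries {w : ℂ} (hw : 1 < w.re) :
    zetaInv w = LSeries (fun n ↦ (ArithmeticFunction.moebius n : ℂ)) w := by
  have h1 : w ≠ 1 := by intro h; rw [h] at hw; simp at hw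
  rw [zetaInv_of_ne_one h1]
  exact MertensBoundRH.inv_riemannZeta_eq_LSeries hw

/-! ## The Mellin–Barnes integrand -/

/-- The Mellin–Barnes integrand `G_{s,X}(z) = Γ(z) X^z (zetaInv(s+z) - zetaInv(s))`, written as
`Γ(z+1) X^z · (zetaInv(s+z) - zetaInv(s))/z` so as to be holomorphic at `z = 0` (the simple pole
of `Γ` is cancelled). [folklore] -/
def mbIntegrand (s : ℂ) (X : ℝ) (z : ℂ) : ℂ :=
  Complex.Gamma (z + 1) * (X : ℂ) ^ z * dslope (fun u : ℂ ↦ zetaInv (s + u)) 0 z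

/-- Off `z = 0`: `G_{s,X}(z) = Γ(z) X^z (zetaInv(s+z) - zetaInv(s))`. [folklore] -/
lemma mbIntegrand_of_ne_zero (s : ℂ) (X : ℝ) {z : ℂ} (hz : z ≠ 0) :
    mbIntegrand s X z = Complex.Gamma z * (X : ℂ) ^ z * (zetaInv (s + z) - zetaInv s) := by
  unfold mbIntegrand
  rw [dslope_of_ne _ hz, slope_def_field, sub_zero, add_zero, Complex.Gamma_add_one _ hz]
  field_simp

/-- **Holomorphy of the integrand.** Under RH, for `X > 0`, `G_{s,X}` is holomorphic on
`{z : -1 < re z, 1/2 < re (s+z)}` (which is a neighbourhood of `0` when `re s > 1/2`).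
[folklore] -/
theorem differentiableOn_mbIntegrand (hRH : RiemannHypothesis) {s : ℂ} (hs : 1 / 2 < s.re)
    {X : ℝ} (hX : 0 < X) :
    DifferentiableOn ℂ (mbIntegrand s X) {z : ℂ | -1 < z.re ∧ 1 / 2 < (s + z).re} := by
  set U : Set ℂ := {z : ℂ | -1 < z.re ∧ 1 / 2 < (s + z).re} with hU
  have hUo : IsOpen U := by
    refine IsOpen.inter (continuous_re.isOpen_preimage _ isOpen_Ioi) ?_
    exact (continuous_re.comp (continuous_const.add continuous_id)).isOpen_preimage _ isOpen_Ioi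
  have h0U : (0 : ℂ) ∈ U := by
    simp only [hU, mem_setOf_eq, zero_re, add_zero]
    constructor <;> linarith
  have hUn : U ∈ 𝓝 (0 : ℂ) := hUo.mem_nhds h0U
  -- the three factors
  have hΓ : DifferentiableOn ℂ (fun z ↦ Complex.Gamma (z + 1)) U := by
    intro z hz
    refine (DifferentiableAt.comp z (Complex.differentiableAt_Gamma _ fun m h ↦ ?_)
      (differentiableAt_id.add_const 1)).differentiableWithinAt
    have := congrArg Complex.re h
    simp at this
    have hz1 := hz.1
    have hm : (0 : ℝ) ≤ m := m.cast_nonneg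
    linarith
  have hX' : DifferentiableOn ℂ (fun z ↦ (X : ℂ) ^ z) U := fun z _ ↦
    (differentiableAt_id.const_cpow (Or.inl (ofReal_ne_zero.2 hX.ne'))).differentiableWithinAt
  have hinv : DifferentiableOn ℂ (fun u : ℂ ↦ zetaInv (s + u)) U := by
    intro z hz
    have h := MertensBoundRH.differentiableOn_zetaInv hRH (s + z) hz.2
    have h' : DifferentiableAt ℂ zetaInv (s + z) :=
      h.differentiableAt ((continuous_re.isOpen_preimage _ isOpen_Ioi).mem_nhds hz.2)
    exact (h'.comp z (differentiableAt_id.const_add s)).differentiableWithinAt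
  have hds : DifferentiableOn ℂ (dslope (fun u : ℂ ↦ zetaInv (s + u)) 0) U :=
    (differentiableOn_dslope hUn).2 hinv
  exact (hΓ.mul hX').mul hds

/-- The closed strip `-κ ≤ re z ≤ 2` lies in the holomorphy domain when `1/2 + κ < re s`,
`κ < 1`. [folklore] -/
lemma strip_subset {s : ℂ} {κ : ℝ} (hκ1 : κ < 1) (hs : 1 / 2 + κ < s.re) :
    (Icc (-κ) 2 ×ℂ univ) ⊆ {z : ℂ | -1 < z.re ∧ 1 / 2 < (s + z).re} := by
  intro z hz
  have h1 : -κ ≤ z.re := hz.1.1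
  simp only [mem_setOf_eq, add_re]
  constructor <;> linarith

/-! ## The line `re z = 2`: Mellin–Barnes evaluation -/

/-- The smoothed Möbius coefficients `μ(a) e^{-a/X}`. [folklore] -/
def smoothedMoebius (X : ℝ) (a : ℕ) : ℂ :=
  (ArithmeticFunction.moebius a : ℂ) * (Real.exp (-(a / X)) : ℂ)

/-- `|μ(a)| ≤ 1` in `ℂ`. [folklore] -/
lemma norm_moebius_le_one (a : ℕ) : ‖(ArithmeticFunction.moebius a : ℂ)‖ ≤ 1 := by
  rw [Complex.norm_intCast, ← Int.cast_abs]
  exact_mod_cast ArithmeticFunction.abs_moebius_le_one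

/-- `‖μ(a) e^{-a/X}‖ ≤ e^{-a/X}`. [folklore] -/
lemma norm_smoothedMoebius_le (X : ℝ) (a : ℕ) : ‖smoothedMoebius X a‖ ≤ Real.exp (-(a / X)) := by
  unfold smoothedMoebius
  rw [norm_mul, Complex.norm_real, Real.norm_of_nonneg (Real.exp_pos _).le]
  exact (mul_le_of_le_one_left (Real.exp_pos _).le (norm_moebius_le_one a))

/-- `((X⁻¹)^{-w} = X^w` for `X > 0`. [folklore] -/
lemma inv_ofReal_cpow_neg {X : ℝ} (hX : 0 < X) (w : ℂ) : ((X⁻¹ : ℝ) : ℂ) ^ (-w) = (X : ℂ) ^ w := by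
  rw [ofReal_inv, Complex.inv_cpow _ _ (by rw [arg_ofReal_of_nonneg hX.le]; exact Real.pi_ne_zero.symm),
    cpow_neg, inv_inv]

/-- `(a/X)^{-w} = a^{-w} X^{w}` for `a ≥ 0`, `X > 0`. [folklore] -/
lemma div_ofReal_cpow_neg {a X : ℝ} (ha : 0 ≤ a) (hX : 0 < X) (w : ℂ) :
    ((a / X : ℝ) : ℂ) ^ (-w) = (a : ℂ) ^ (-w) * (X : ℂ) ^ w := by
  rw [div_eq_mul_inv, ofReal_mul, mul_cpow_ofReal_nonneg ha (inv_nonneg.2 hX.le),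
    inv_ofReal_cpow_neg hX]

/-- **`∫ x^{-(2+iy)} Γ(2+iy) dy = 2π e^{-x}`** (`x > 0`), the Mellin–Barnes formula for `e^{-x}`
as a plain integral. [folklore] -/
lemma integral_cpow_neg_mul_Gamma {x : ℝ} (hx : 0 < x) :
    ∫ y : ℝ, (x : ℂ) ^ (-(2 + y * I)) * Complex.Gamma (2 + y * I) = 2 * π * Real.exp (-x) := by
  have key : (∫ y : ℝ, (x : ℂ) ^ (-(2 + y * I)) * Complex.Gamma (2 + y * I)) =
      (2 * π : ℝ) • mellinInv 2 Complex.Gamma x := by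
    unfold mellinInv
    rw [smul_smul, mul_one_div_cancel (by positivity : (2 * π : ℝ) ≠ 0), one_smul]
    refine integral_congr_ae (Eventually.of_forall fun y ↦ ?_)
    simp only [smul_eq_mul]
    push_cast
    rfl
  rw [key, mellinInv_Gamma_two hx, Complex.real_smul]
  push_cast
  ring

/-- `∫ Γ(2+iy) X^{2+iy} dy = 2π e^{-1/X}` (`X > 0`). [folklore] -/
lemma integral_Gamma_mul_cpow_two {X : ℝ} (hX : 0 < X) :
    ∫ y : ℝ, Complex.Gamma (2 + y * I) * (X : ℂ) ^ (2 + y * I) = 2 * π * Real.exp (-(1 / X)) := by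
  rw [← integral_cpow_neg_mul_Gamma (by positivity : 0 < 1 / X)]
  refine integral_congr_ae (Eventually.of_forall fun y ↦ ?_)
  simp only
  rw [one_div, inv_ofReal_cpow_neg hX, mul_comm]

/-- Norm of `X^{σ+iy}` for `X > 0`. [folklore] -/
lemma norm_ofReal_cpow {X : ℝ} (hX : 0 < X) (w : ℂ) : ‖(X : ℂ) ^ w‖ = X ^ w.re :=
  Complex.norm_cpow_eq_rpow_re_of_pos hX w

/-- `y ↦ Γ(2+iy) X^{2+iy}` is integrable. [folklore] -/
lemma integrable_Gamma_mul_cpow_two {X : ℝ} (hX : 0 < X) :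
    Integrable fun y : ℝ ↦ Complex.Gamma (2 + y * I) * (X : ℂ) ^ (2 + y * I) := by
  have hc : Continuous fun y : ℝ ↦ (X : ℂ) ^ (2 + y * I) :=
    Continuous.const_cpow (by fun_prop) (Or.inl (ofReal_ne_zero.2 hX.ne'))
  have hΓ : Continuous fun y : ℝ ↦ Complex.Gamma (2 + y * I) := by
    have := continuous_Gamma_line (σ := 2) (fun m h ↦ by
      have hm : (0 : ℝ) ≤ m := m.cast_nonneg; linarith)
    simpa using this
  refine ((integrable_Gamma_two_line.norm.mul_const (X ^ (2 : ℝ))).mono'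
    (hΓ.mul hc).aestronglyMeasurable) (Eventually.of_forall fun y ↦ ?_)
  change ‖Complex.Gamma (2 + y * I) * (X : ℂ) ^ (2 + y * I)‖ ≤ _
  rw [norm_mul, norm_ofReal_cpow hX]
  simp

/-- `zetaInv` is Borel measurable. [folklore] -/
lemma measurable_zetaInv : Measurable zetaInv := by
  have hζ : Measurable riemannZeta :=
    measurable_of_continuousOn_compl_singleton 1
      fun _ hs ↦ (differentiableAt_riemannZeta hs).continuousAt.continuousWithinAt
  unfold zetaInv
  have : (Function.update (fun w : ℂ ↦ (riemannZeta w)⁻¹) 1 0) =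
      fun w ↦ if w = 1 then 0 else (riemannZeta w)⁻¹ := by
    funext w; rw [Function.update_apply]
  rw [this]
  exact Measurable.ite (measurableSet_singleton 1) measurable_const hζ.inv

/-- `‖zetaInv w‖ ≤ ∑ n^{-re w}` for `re w > 1`. [folklore] -/
lemma norm_zetaInv_le_tsum {w : ℂ} (hw : 1 < w.re) :
    ‖zetaInv w‖ ≤ ∑' n : ℕ, 1 / (n : ℝ) ^ w.re := by
  rw [zetaInv_eq_LSeries hw, LSeries]
  have hs : Summable fun n : ℕ ↦ 1 / (n : ℝ) ^ w.re := Real.summable_one_div_nat_rpow.2 hw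
  have hle : ∀ n : ℕ, ‖LSeries.term (fun n ↦ (ArithmeticFunction.moebius n : ℂ)) w n‖ ≤
      1 / (n : ℝ) ^ w.re := by
    intro n
    rw [LSeries.norm_term_eq]
    split_ifs with hn
    · positivity
    · exact div_le_div_of_nonneg_right (norm_moebius_le_one n) (by positivity)
  have hs' : Summable fun n : ℕ ↦ ‖LSeries.term (fun n ↦ (ArithmeticFunction.moebius n : ℂ)) w n‖ :=
    Summable.of_nonneg_of_le (fun n ↦ norm_nonneg _) hle hs
  exact (norm_tsum_le_tsum_norm hs').trans (hs'.tsum_le_tsum hle hs)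

/-- The termwise integrands `F_a(y) = Γ(2+iy) X^{2+iy} μ(a) a^{-(s+2+iy)}` are continuous.
[folklore] -/
lemma continuous_termIntegrand {X : ℝ} (hX : 0 < X) (s : ℂ) (a : ℕ) :
    Continuous fun y : ℝ ↦ Complex.Gamma (2 + y * I) * (X : ℂ) ^ (2 + y * I) *
      LSeries.term (fun n ↦ (ArithmeticFunction.moebius n : ℂ)) (s + (2 + y * I)) a := by
  have hΓ : Continuous fun y : ℝ ↦ Complex.Gamma (2 + y * I) := by
    have := continuous_Gamma_line (σ := 2) (fun m h ↦ by
      have hm : (0 : ℝ) ≤ m := m.cast_nonneg; linarith)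
    simpa using this
  have hX' : Continuous fun y : ℝ ↦ (X : ℂ) ^ (2 + y * I) :=
    Continuous.const_cpow (by fun_prop) (Or.inl (ofReal_ne_zero.2 hX.ne'))
  rcases eq_or_ne a 0 with rfl | ha
  · simp only [LSeries.term_zero, mul_zero]; exact continuous_const
  · have ht : Continuous fun y : ℝ ↦
        LSeries.term (fun n ↦ (ArithmeticFunction.moebius n : ℂ)) (s + (2 + y * I)) a := by
      simp only [LSeries.term_of_ne_zero ha]
      exact continuous_const.div (Continuous.const_cpow (by fun_prop)
        (Or.inl (Nat.cast_ne_zero.2 ha))) fun y ↦ (cpow_ne_zero_iff.2 (Or.inl (Nat.cast_ne_zero.2 ha)))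
    exact (hΓ.mul hX').mul ht

/-- Norm bound for the termwise integrands: `‖F_a(y)‖ ≤ X² a^{-(re s+2)} ‖Γ(2+iy)‖`. [folklore] -/
lemma norm_termIntegrand_le {X : ℝ} (hX : 0 < X) (s : ℂ) (a : ℕ) (y : ℝ) :
    ‖Complex.Gamma (2 + y * I) * (X : ℂ) ^ (2 + y * I) *
      LSeries.term (fun n ↦ (ArithmeticFunction.moebius n : ℂ)) (s + (2 + y * I)) a‖ ≤
      X ^ (2 : ℝ) * (1 / (a : ℝ) ^ (s.re + 2)) * ‖Complex.Gamma (2 + y * I)‖ := by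
  rw [norm_mul, norm_mul, norm_ofReal_cpow hX, LSeries.norm_term_eq]
  have hre : (2 + (y : ℂ) * I).re = 2 := by simp
  have hre' : (s + (2 + (y : ℂ) * I)).re = s.re + 2 := by simp
  rw [hre, hre']
  split_ifs with ha
  · subst ha
    simp only [mul_zero]
    positivity
  · have h1 : ‖(ArithmeticFunction.moebius a : ℂ)‖ / (a : ℝ) ^ (s.re + 2) ≤ 1 / (a : ℝ) ^ (s.re + 2) :=
      div_le_div_of_nonneg_right (norm_moebius_le_one a) (by positivity)
    have h0 : 0 ≤ ‖Complex.Gamma (2 + y * I)‖ * X ^ (2 : ℝ) := by positivity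
    calc ‖Complex.Gamma (2 + y * I)‖ * X ^ (2 : ℝ) *
          (‖(ArithmeticFunction.moebius a : ℂ)‖ / (a : ℝ) ^ (s.re + 2))
        ≤ ‖Complex.Gamma (2 + y * I)‖ * X ^ (2 : ℝ) * (1 / (a : ℝ) ^ (s.re + 2)) :=
          mul_le_mul_of_nonneg_left h1 h0
      _ = _ := by ring

/-- **Termwise Mellin–Barnes**: for `a ≥ 1`,
`∫ Γ(2+iy) X^{2+iy} μ(a) a^{-(s+2+iy)} dy = 2π μ(a) e^{-a/X} a^{-s}`. [folklore] -/
lemma integral_termIntegrand {X : ℝ} (hX : 0 < X) (s : ℂ) {a : ℕ} (ha : a ≠ 0) :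
    ∫ y : ℝ, Complex.Gamma (2 + y * I) * (X : ℂ) ^ (2 + y * I) *
        LSeries.term (fun n ↦ (ArithmeticFunction.moebius n : ℂ)) (s + (2 + y * I)) a =
      2 * π * LSeries.term (smoothedMoebius X) s a := by
  have ha0 : (a : ℂ) ≠ 0 := Nat.cast_ne_zero.2 ha
  have hpt : ∀ y : ℝ, Complex.Gamma (2 + y * I) * (X : ℂ) ^ (2 + y * I) *
      LSeries.term (fun n ↦ (ArithmeticFunction.moebius n : ℂ)) (s + (2 + y * I)) a =
      ((ArithmeticFunction.moebius a : ℂ) / (a : ℂ) ^ s) *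
        ((((a : ℝ) / X : ℝ) : ℂ) ^ (-(2 + y * I)) * Complex.Gamma (2 + y * I)) := by
    intro y
    have e1 : (a : ℂ) ^ (s + (2 + y * I)) = (a : ℂ) ^ s * (a : ℂ) ^ (2 + y * I) :=
      cpow_add _ _ ha0
    have e2 : (((a : ℝ) / X : ℝ) : ℂ) ^ (-(2 + y * I)) =
        ((a : ℂ) ^ (2 + y * I))⁻¹ * (X : ℂ) ^ (2 + y * I) := by
      rw [div_ofReal_cpow_neg (Nat.cast_nonneg a) hX, cpow_neg, ofReal_natCast]
    have h1 : (a : ℂ) ^ s ≠ 0 := cpow_ne_zero_iff.2 (Or.inl ha0)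
    have h2 : (a : ℂ) ^ (2 + y * I) ≠ 0 := cpow_ne_zero_iff.2 (Or.inl ha0)
    rw [LSeries.term_of_ne_zero ha, e1, e2]
    field_simp
  simp_rw [hpt]
  rw [integral_const_mul, integral_cpow_neg_mul_Gamma (by positivity), LSeries.term_of_ne_zero ha]
  unfold smoothedMoebius
  have h1 : (a : ℂ) ^ s ≠ 0 := cpow_ne_zero_iff.2 (Or.inl ha0)
  push_cast
  field_simp

/-- **The line `re z = 2`, first part**: `∫ Γ(2+iy) X^{2+iy} zetaInv(s+2+iy) dy = 2π ∑ μ(a)e^{-a/X}a^{-s}`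
for `re s > -1` (absolutely convergent Dirichlet series, termwise Mellin–Barnes, and
`∫∑ = ∑∫`). [folklore] -/
theorem integral_Gamma_cpow_zetaInv_two {X : ℝ} (hX : 0 < X) {s : ℂ} (hs : -1 < s.re) :
    ∫ y : ℝ, Complex.Gamma (2 + y * I) * (X : ℂ) ^ (2 + y * I) * zetaInv (s + (2 + y * I)) =
      2 * π * LSeries (smoothedMoebius X) s := by
  set F : ℕ → ℝ → ℂ := fun a y ↦ Complex.Gamma (2 + y * I) * (X : ℂ) ^ (2 + y * I) *
    LSeries.term (fun n ↦ (ArithmeticFunction.moebius n : ℂ)) (s + (2 + y * I)) a with hF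
  have hp : 1 < s.re + 2 := by linarith
  -- pointwise expansion
  have hpt : ∀ y : ℝ, Complex.Gamma (2 + y * I) * (X : ℂ) ^ (2 + y * I) * zetaInv (s + (2 + y * I)) =
      ∑' a, F a y := by
    intro y
    have hre : 1 < (s + (2 + (y : ℂ) * I)).re := by simp; linarith
    rw [zetaInv_eq_LSeries hre, LSeries, ← tsum_mul_left]
  -- integrability of each term
  have hint : ∀ a, Integrable (F a) := fun a ↦
    ((integrable_Gamma_two_line.norm.const_mul (X ^ (2 : ℝ) * (1 / (a : ℝ) ^ (s.re + 2)))).mono'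
      (continuous_termIntegrand hX s a).aestronglyMeasurable
      (Eventually.of_forall fun y ↦ by simpa [hF, mul_assoc] using norm_termIntegrand_le hX s a y))
  -- summability of the integrated norms
  set LΓ : ℝ := ∫ y : ℝ, ‖Complex.Gamma (2 + y * I)‖ with hLΓ
  have hsum : Summable fun a ↦ ∫ y, ‖F a y‖ := by
    refine Summable.of_nonneg_of_le (fun a ↦ integral_nonneg fun y ↦ norm_nonneg _)
      (fun a ↦ ?_) (((Real.summable_one_div_nat_rpow.2 hp).mul_left (X ^ (2 : ℝ) * LΓ)))
    calc ∫ y, ‖F a y‖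
        ≤ ∫ y : ℝ, X ^ (2 : ℝ) * (1 / (a : ℝ) ^ (s.re + 2)) * ‖Complex.Gamma (2 + y * I)‖ :=
          integral_mono (hint a).norm
            (integrable_Gamma_two_line.norm.const_mul _) fun y ↦ norm_termIntegrand_le hX s a y
      _ = X ^ (2 : ℝ) * LΓ * (1 / (a : ℝ) ^ (s.re + 2)) := by
          rw [integral_const_mul, hLΓ]; ring
  -- termwise values
  have hval : ∀ a, ∫ y, F a y = 2 * π * LSeries.term (smoothedMoebius X) s a := by
    intro a
    rcases eq_or_ne a 0 with rfl | ha
    · simp [hF, LSeries.term_zero]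
    · exact integral_termIntegrand hX s ha
  calc ∫ y : ℝ, Complex.Gamma (2 + y * I) * (X : ℂ) ^ (2 + y * I) * zetaInv (s + (2 + y * I))
      = ∫ y : ℝ, ∑' a, F a y := integral_congr_ae (Eventually.of_forall hpt)
    _ = ∑' a, ∫ y, F a y := (integral_tsum_of_summable_integral_norm hint hsum).symm
    _ = ∑' a, 2 * π * LSeries.term (smoothedMoebius X) s a := tsum_congr hval
    _ = 2 * π * LSeries (smoothedMoebius X) s := by rw [tsum_mul_left, LSeries]

/-- `y ↦ Γ(2+iy) X^{2+iy} zetaInv(s+2+iy)` is integrable (`re s > -1`). [folklore] -/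
lemma integrable_Gamma_cpow_zetaInv_two {X : ℝ} (hX : 0 < X) {s : ℂ} (hs : -1 < s.re) :
    Integrable fun y : ℝ ↦
      Complex.Gamma (2 + y * I) * (X : ℂ) ^ (2 + y * I) * zetaInv (s + (2 + y * I)) := by
  set Z : ℝ := ∑' n : ℕ, 1 / (n : ℝ) ^ (s.re + 2) with hZ
  have hm : AEStronglyMeasurable (fun y : ℝ ↦
      Complex.Gamma (2 + y * I) * (X : ℂ) ^ (2 + y * I) * zetaInv (s + (2 + y * I))) volume :=
    ((integrable_Gamma_mul_cpow_two hX).aestronglyMeasurable.mul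
      ((measurable_zetaInv.comp (by fun_prop)).aestronglyMeasurable))
  refine ((integrable_Gamma_mul_cpow_two hX).norm.mul_const Z).mono' hm
    (Eventually.of_forall fun y ↦ ?_)
  rw [norm_mul]
  refine mul_le_mul_of_nonneg_left ?_ (norm_nonneg _)
  have hre : (s + (2 + (y : ℂ) * I)).re = s.re + 2 := by simp
  have := norm_zetaInv_le_tsum (w := s + (2 + y * I)) (by rw [hre]; linarith)
  rwa [hre] at this

/-- **The line `re z = 2`**: `∫ G_{s,X}(2+iy) dy = 2π ∑_a μ(a)e^{-a/X}a^{-s} - 2π e^{-1/X} zetaInv(s)`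
(`re s > -1`, `X > 0`). [folklore] -/
theorem integral_mbIntegrand_two {X : ℝ} (hX : 0 < X) {s : ℂ} (hs : -1 < s.re) :
    ∫ y : ℝ, mbIntegrand s X (2 + y * I) =
      2 * π * LSeries (smoothedMoebius X) s - 2 * π * Real.exp (-(1 / X)) * zetaInv s := by
  have hpt : ∀ y : ℝ, mbIntegrand s X (2 + y * I) =
      Complex.Gamma (2 + y * I) * (X : ℂ) ^ (2 + y * I) * zetaInv (s + (2 + y * I)) -
        Complex.Gamma (2 + y * I) * (X : ℂ) ^ (2 + y * I) * zetaInv s := by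
    intro y
    have hne : (2 + (y : ℂ) * I) ≠ 0 := by
      intro h; have := congrArg Complex.re h; simp at this
    rw [mbIntegrand_of_ne_zero s X hne, mul_sub]
  rw [integral_congr_ae (Eventually.of_forall hpt), integral_sub
    (integrable_Gamma_cpow_zetaInv_two hX hs) ((integrable_Gamma_mul_cpow_two hX).mul_const _),
    integral_Gamma_cpow_zetaInv_two hX hs, integral_mul_const, integral_Gamma_mul_cpow_two hX]

/-- `y ↦ G_{s,X}(2+iy)` is integrable. [folklore] -/
lemma integrable_mbIntegrand_two {X : ℝ} (hX : 0 < X) {s : ℂ} (hs : -1 < s.re) :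
    Integrable fun y : ℝ ↦ mbIntegrand s X (2 + y * I) := by
  have h := (integrable_Gamma_cpow_zetaInv_two hX hs).sub
    ((integrable_Gamma_mul_cpow_two hX).mul_const (zetaInv s))
  refine h.congr (Eventually.of_forall fun y ↦ ?_)
  have hne : (2 + (y : ℂ) * I) ≠ 0 := by
    intro h; have := congrArg Complex.re h; simp at this
  simp only [Pi.sub_apply]
  rw [mbIntegrand_of_ne_zero s X hne, mul_sub]

/-! ## The line `re z = -κ` and the horizontal segments -/

/-- `(1+|τ+y|)^{1/8} ≤ (1+|τ|)^{1/8}(1+|y|)^{1/8}`. [folklore] -/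
lemma one_add_abs_add_rpow_le (τ y : ℝ) :
    (1 + |τ + y|) ^ (1 / 8 : ℝ) ≤ (1 + |τ|) ^ (1 / 8 : ℝ) * (1 + |y|) ^ (1 / 8 : ℝ) := by
  rw [← Real.mul_rpow (by positivity) (by positivity)]
  refine Real.rpow_le_rpow (by positivity) ?_ (by norm_num)
  have := abs_add_le τ y
  nlinarith [abs_nonneg τ, abs_nonneg y]

/-- The difference `zetaInv(s+z) - zetaInv(s)` on the strip: if `‖zetaInv w‖ ≤ C(1+|im w|)^{1/8}` for
`re w ≥ σ₀`, then for `re (s+z) ≥ σ₀`, `re s ≥ σ₀`: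
`‖zetaInv(s+z) - zetaInv(s)‖ ≤ 2C(1+|im s|)^{1/8}(1+|im z|)^{1/8}`. [folklore] -/
lemma norm_zetaInv_sub_le {σ₀ C : ℝ} (hC0 : 0 ≤ C)
    (hC : ∀ w : ℂ, σ₀ ≤ w.re → ‖zetaInv w‖ ≤ C * (1 + |w.im|) ^ (1 / 8 : ℝ)) {s z : ℂ}
    (hsz : σ₀ ≤ (s + z).re) (hs : σ₀ ≤ s.re) :
    ‖zetaInv (s + z) - zetaInv s‖ ≤
      2 * C * (1 + |s.im|) ^ (1 / 8 : ℝ) * (1 + |z.im|) ^ (1 / 8 : ℝ) := by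
  have h1 := hC (s + z) hsz
  have h2 := hC s hs
  rw [add_im] at h1
  have h3 := one_add_abs_add_rpow_le s.im z.im
  have h4 : 1 ≤ (1 + |z.im|) ^ (1 / 8 : ℝ) := Real.one_le_rpow (by linarith [abs_nonneg z.im]) (by norm_num)
  have h5 : 0 ≤ (1 + |s.im|) ^ (1 / 8 : ℝ) := by positivity
  calc ‖zetaInv (s + z) - zetaInv s‖ ≤ ‖zetaInv (s + z)‖ + ‖zetaInv s‖ := norm_sub_le _ _
    _ ≤ C * ((1 + |s.im|) ^ (1 / 8 : ℝ) * (1 + |z.im|) ^ (1 / 8 : ℝ)) +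
        C * ((1 + |s.im|) ^ (1 / 8 : ℝ) * (1 + |z.im|) ^ (1 / 8 : ℝ)) := by
        refine add_le_add (h1.trans (mul_le_mul_of_nonneg_left h3 hC0)) (h2.trans ?_)
        refine mul_le_mul_of_nonneg_left ?_ hC0
        exact le_mul_of_one_le_right h5 h4
    _ = _ := by ring

/-- **The line `re z = -κ`: pointwise bound**
`‖G_{s,X}(-κ+iy)‖ ≤ 2C X^{-κ}(1+|im s|)^{1/8} · ‖Γ(-κ+iy)‖(1+|y|)^{1/8}`. [folklore] -/
lemma norm_mbIntegrand_neg_le {κ σ₀ C X : ℝ} (hκ : 0 < κ) (hC0 : 0 ≤ C)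
    (hC : ∀ w : ℂ, σ₀ ≤ w.re → ‖zetaInv w‖ ≤ C * (1 + |w.im|) ^ (1 / 8 : ℝ)) (hX : 0 < X)
    {s : ℂ} (hs : σ₀ + κ ≤ s.re) (y : ℝ) :
    ‖mbIntegrand s X (-κ + y * I)‖ ≤ 2 * C * X ^ (-κ) * (1 + |s.im|) ^ (1 / 8 : ℝ) *
      (‖Complex.Gamma (-κ + y * I)‖ * (1 + |y|) ^ (1 / 8 : ℝ)) := by
  have hne : (-κ + (y : ℂ) * I) ≠ 0 := by
    intro h; have := congrArg Complex.re h; simp at this; linarith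
  rw [mbIntegrand_of_ne_zero s X hne, norm_mul, norm_mul, norm_ofReal_cpow hX]
  have hre : (-κ + (y : ℂ) * I).re = -κ := by simp
  have him : (-κ + (y : ℂ) * I).im = y := by simp
  rw [hre]
  have hd := norm_zetaInv_sub_le hC0 hC (s := s) (z := -κ + y * I) (by simp; linarith)
    (by linarith)
  rw [him] at hd
  have h0 : 0 ≤ ‖Complex.Gamma (-κ + y * I)‖ * X ^ (-κ) := by positivity
  calc ‖Complex.Gamma (-κ + y * I)‖ * X ^ (-κ) * ‖zetaInv (s + (-κ + y * I)) - zetaInv s‖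
      ≤ ‖Complex.Gamma (-κ + y * I)‖ * X ^ (-κ) *
        (2 * C * (1 + |s.im|) ^ (1 / 8 : ℝ) * (1 + |y|) ^ (1 / 8 : ℝ)) :=
        mul_le_mul_of_nonneg_left hd h0
    _ = _ := by ring

/-- `y ↦ G_{s,X}(-κ+iy)` is integrable. [folklore] -/
lemma integrable_mbIntegrand_neg {κ σ₀ C X : ℝ} (hκ : 0 < κ) (hκ2 : κ ≤ 1 / 2) (hC0 : 0 ≤ C)
    (hC : ∀ w : ℂ, σ₀ ≤ w.re → ‖zetaInv w‖ ≤ C * (1 + |w.im|) ^ (1 / 8 : ℝ)) (hX : 0 < X)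
    {s : ℂ} (hs : σ₀ + κ ≤ s.re) :
    Integrable fun y : ℝ ↦ mbIntegrand s X (-κ + y * I) := by
  have hne : ∀ y : ℝ, (-κ + (y : ℂ) * I) ≠ 0 := fun y h ↦ by
    have := congrArg Complex.re h; simp at this; linarith
  have hΓ : Continuous fun y : ℝ ↦ Complex.Gamma (-κ + y * I) := by
    have := continuous_Gamma_line (σ := -κ) (fun m h ↦ by
      have hm : (0 : ℝ) ≤ m := m.cast_nonneg
      rcases Nat.eq_zero_or_pos m with h0 | h0
      · subst h0; simp at h; linarith
      · have : (1 : ℝ) ≤ m := by exact_mod_cast h0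
        linarith)
    simpa using this
  have hXc : Continuous fun y : ℝ ↦ (X : ℂ) ^ (-κ + y * I) :=
    Continuous.const_cpow (by fun_prop) (Or.inl (ofReal_ne_zero.2 hX.ne'))
  have hm : AEStronglyMeasurable (fun y : ℝ ↦ Complex.Gamma (-κ + y * I) * (X : ℂ) ^ (-κ + y * I) *
      (zetaInv (s + (-κ + y * I)) - zetaInv s)) volume :=
    ((hΓ.mul hXc).aestronglyMeasurable.mul
      (((measurable_zetaInv.comp (by fun_prop)).sub measurable_const).aestronglyMeasurable))
  have hI := (integrable_Gamma_neg_line_rpow hκ hκ2).const_mul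
    (2 * C * X ^ (-κ) * (1 + |s.im|) ^ (1 / 8 : ℝ))
  refine (hI.mono' ?_ (Eventually.of_forall fun y ↦ ?_))
  · refine hm.congr (Eventually.of_forall fun y ↦ ?_)
    change _ = mbIntegrand s X (-κ + y * I)
    rw [mbIntegrand_of_ne_zero s X (hne y)]
  · exact norm_mbIntegrand_neg_le hκ hC0 hC hX hs y

/-- **The line `re z = -κ`: integrated bound**
`‖∫ G_{s,X}(-κ+iy) dy‖ ≤ 2C I_κ X^{-κ} (1+|im s|)^{1/8}`, `I_κ = ∫‖Γ(-κ+iy)‖(1+|y|)^{1/8}dy`.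
[folklore] -/
theorem norm_integral_mbIntegrand_neg_le {κ σ₀ C X : ℝ} (hκ : 0 < κ) (hκ2 : κ ≤ 1 / 2)
    (hC0 : 0 ≤ C) (hC : ∀ w : ℂ, σ₀ ≤ w.re → ‖zetaInv w‖ ≤ C * (1 + |w.im|) ^ (1 / 8 : ℝ))
    (hX : 0 < X) {s : ℂ} (hs : σ₀ + κ ≤ s.re) :
    ‖∫ y : ℝ, mbIntegrand s X (-κ + y * I)‖ ≤ 2 * C * X ^ (-κ) * (1 + |s.im|) ^ (1 / 8 : ℝ) *
      ∫ y : ℝ, ‖Complex.Gamma (-κ + y * I)‖ * (1 + |y|) ^ (1 / 8 : ℝ) := by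
  have hI := (integrable_Gamma_neg_line_rpow hκ hκ2).const_mul
    (2 * C * X ^ (-κ) * (1 + |s.im|) ^ (1 / 8 : ℝ))
  have h := norm_integral_le_of_norm_le hI
    (Eventually.of_forall fun y ↦ norm_mbIntegrand_neg_le hκ hC0 hC hX hs y)
  rwa [integral_const_mul] at h

/-- **Horizontal decay of the integrand**: for `-κ ≤ x ≤ 2`, `|Y| ≥ 1`, `X ≥ 1`:
`‖G_{s,X}(x+iY)‖ ≤ 96 C X² (1+|im s|)^{1/8}/|Y|²`. [folklore] -/
lemma norm_mbIntegrand_horiz_le {κ σ₀ C X : ℝ} (hκ : 0 < κ) (hκ2 : κ ≤ 1 / 2) (hC0 : 0 ≤ C)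
    (hC : ∀ w : ℂ, σ₀ ≤ w.re → ‖zetaInv w‖ ≤ C * (1 + |w.im|) ^ (1 / 8 : ℝ)) (hX : 1 ≤ X)
    {s : ℂ} (hs : σ₀ + κ ≤ s.re) (x Y : ℝ) (hx1 : -κ ≤ x) (hx2 : x ≤ 2) (hY : 1 ≤ |Y|) :
    ‖mbIntegrand s X (x + Y * I)‖ ≤ 96 * C * X ^ (2 : ℝ) * (1 + |s.im|) ^ (1 / 8 : ℝ) / |Y| ^ 2 := by
  have hX0 : 0 < X := by linarith
  have hY0 : 0 < |Y| := by linarith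
  have hne : ((x : ℂ) + Y * I) ≠ 0 := by
    intro h; have := congrArg Complex.im h; simp at this; rw [this] at hY; simp at hY; linarith
  rw [mbIntegrand_of_ne_zero s X hne, norm_mul, norm_mul, norm_ofReal_cpow hX0]
  have hre : ((x : ℂ) + Y * I).re = x := by simp
  have him : ((x : ℂ) + Y * I).im = Y := by simp
  rw [hre]
  have hΓ := norm_Gamma_horiz_le (x := x) (Y := Y) (by linarith) hx2 hY
  have hXx : X ^ x ≤ X ^ (2 : ℝ) := Real.rpow_le_rpow_of_exponent_le hX hx2
  have hd := norm_zetaInv_sub_le hC0 hC (s := s) (z := x + Y * I) (by simp; linarith) (by linarith)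
  rw [him] at hd
  have hY8 : (1 + |Y|) ^ (1 / 8 : ℝ) ≤ 2 * |Y| := by
    calc (1 + |Y|) ^ (1 / 8 : ℝ) ≤ (1 + |Y|) ^ (1 : ℝ) :=
          Real.rpow_le_rpow_of_exponent_le (by linarith) (by norm_num)
      _ = 1 + |Y| := Real.rpow_one _
      _ ≤ 2 * |Y| := by linarith
  have hT : 0 ≤ (1 + |s.im|) ^ (1 / 8 : ℝ) := by positivity
  have hd' : ‖zetaInv (s + (x + Y * I)) - zetaInv s‖ ≤ 2 * C * (1 + |s.im|) ^ (1 / 8 : ℝ) * (2 * |Y|) :=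
    hd.trans (mul_le_mul_of_nonneg_left hY8 (by positivity))
  calc ‖Complex.Gamma (x + Y * I)‖ * X ^ x * ‖zetaInv (s + (x + Y * I)) - zetaInv s‖
      ≤ (24 / |Y| ^ 3) * X ^ (2 : ℝ) * (2 * C * (1 + |s.im|) ^ (1 / 8 : ℝ) * (2 * |Y|)) := by
        refine mul_le_mul (mul_le_mul hΓ hXx (Real.rpow_nonneg hX0.le _) (by positivity)) hd'
          (norm_nonneg _) (by positivity)
    _ = 96 * C * X ^ (2 : ℝ) * (1 + |s.im|) ^ (1 / 8 : ℝ) / |Y| ^ 2 := by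
        field_simp
        ring

/-! ## The main estimate -/

/-- **Mellin–Barnes estimate for the smoothed Möbius sums.** Under RH, let `0 < κ ≤ 1/2`,
`σ₀ > 1/2`, and `‖zetaInv w‖ ≤ C(1+|im w|)^{1/8}` for `re w ≥ σ₀` (Titchmarsh (14.2.6),
`exists_norm_zetaInv_le`). Then for `X ≥ 1` and `re s ≥ σ₀ + κ`,
`‖∑_a μ(a)e^{-a/X}a^{-s} - zetaInv(s)‖ ≤ (C I_κ/π + C) X^{-κ} (1+|im s|)^{1/8}`.
Proof: `2π ∑ - 2π e^{-1/X} zetaInv(s) = ∫ G_{s,X}(2+iy)dy = ∫ G_{s,X}(-κ+iy)dy` (holomorphy of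
`G_{s,X}` on `-κ ≤ re z ≤ 2` under RH and Cauchy's theorem), the last integral being
`O(X^{-κ}(1+|im s|)^{1/8})`, and `1 - e^{-1/X} ≤ 1/X ≤ X^{-κ}`.
[cite: Titchmarsh1986, Thm 14.2 (14.2.6) and §14.25 (method)] -/
theorem norm_LSeries_smoothedMoebius_sub_zetaInv_le (hRH : RiemannHypothesis) {κ σ₀ C : ℝ}
    (hκ : 0 < κ) (hκ2 : κ ≤ 1 / 2) (hσ₀ : 1 / 2 < σ₀) (hC0 : 0 ≤ C)
    (hC : ∀ w : ℂ, σ₀ ≤ w.re → ‖zetaInv w‖ ≤ C * (1 + |w.im|) ^ (1 / 8 : ℝ))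
    {X : ℝ} (hX : 1 ≤ X) {s : ℂ} (hs : σ₀ + κ ≤ s.re) :
    ‖LSeries (smoothedMoebius X) s - zetaInv s‖ ≤
      (C * (∫ y : ℝ, ‖Complex.Gamma (-κ + y * I)‖ * (1 + |y|) ^ (1 / 8 : ℝ)) / π + C) *
        X ^ (-κ) * (1 + |s.im|) ^ (1 / 8 : ℝ) := by
  have hX0 : 0 < X := by linarith
  have hπ := Real.pi_pos
  have hs2 : 1 / 2 + κ < s.re := by linarith
  have hs1 : -1 < s.re := by linarith
  set Iκ : ℝ := ∫ y : ℝ, ‖Complex.Gamma (-κ + y * I)‖ * (1 + |y|) ^ (1 / 8 : ℝ) with hIκ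
  have hIκ0 : 0 ≤ Iκ := integral_nonneg fun y ↦ by positivity
  set T : ℝ := (1 + |s.im|) ^ (1 / 8 : ℝ) with hT
  have hT1 : 1 ≤ T := Real.one_le_rpow (by linarith [abs_nonneg s.im]) (by norm_num)
  set E : ℂ := ∫ y : ℝ, mbIntegrand s X (-κ + y * I) with hE
  -- contour shift
  have hd : DifferentiableOn ℂ (mbIntegrand s X) (Icc (-κ) 2 ×ℂ univ) :=
    (differentiableOn_mbIntegrand hRH (by linarith) hX0).mono (strip_subset (by linarith) hs2)
  -- uniform decay on the horizontal sides, from `‖G(x+iY)‖ ≤ B/|Y|²`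
  set B : ℝ := 96 * C * X ^ (2 : ℝ) * (1 + |s.im|) ^ (1 / 8 : ℝ) with hBdef
  have hB0 : 0 ≤ B := by positivity
  have hdecay : ∀ e : ℝ, 0 < e → ∃ T₀ : ℝ, ∀ x ∈ Icc (-κ) 2, ∀ Y : ℝ, T₀ ≤ |Y| →
      ‖mbIntegrand s X (x + Y * I)‖ ≤ e := by
    intro e he
    refine ⟨max 1 (B / e + 1), fun x hx Y hY ↦ ?_⟩
    have hY1 : 1 ≤ |Y| := le_trans (le_max_left _ _) hY
    have hY2 : B / e + 1 ≤ |Y| := le_trans (le_max_right _ _) hY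
    have hY0 : 0 < |Y| := by linarith
    have h1 := norm_mbIntegrand_horiz_le hκ hκ2 hC0 hC hX hs x Y hx.1 hx.2 hY1
    rw [← hBdef] at h1
    have h2 : B / |Y| ^ 2 ≤ B / |Y| :=
      div_le_div_of_nonneg_left hB0 hY0 (by nlinarith)
    have h3 : B / |Y| ≤ B / (B / e + 1) :=
      div_le_div_of_nonneg_left hB0 (by positivity) hY2
    have h4 : B / (B / e + 1) ≤ e := by
      rw [div_le_iff₀ (by positivity)]
      have : e * (B / e + 1) = B + e := by field_simp
      linarith
    linarith
  have hshift : E = ∫ y : ℝ, mbIntegrand s X (2 + y * I) := by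
    have h := MertensBoundRH.integral_vertical_eq_of_tendsto (mbIntegrand s X) (a := -κ) (b := 2)
      (by linarith) hd ?_ (integrable_mbIntegrand_two hX0 hs1) hdecay
    · simpa using h
    · have := integrable_mbIntegrand_neg hκ hκ2 hC0 hC hX0 hs
      simpa using this
  rw [integral_mbIntegrand_two hX0 hs1] at hshift
  -- the identity `L - zetaInv s = E/(2π) + (e^{-1/X} - 1) zetaInv s`
  set L := LSeries (smoothedMoebius X) s with hL
  have hid : L - zetaInv s = E / (2 * π) + ((Real.exp (-(1 / X)) : ℂ) - 1) * zetaInv s := by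
    rw [hshift]
    field_simp
    ring
  -- bounds
  have hEn : ‖E‖ ≤ 2 * C * X ^ (-κ) * T * Iκ :=
    norm_integral_mbIntegrand_neg_le hκ hκ2 hC0 hC hX0 hs
  have hexp : ‖((Real.exp (-(1 / X)) : ℂ) - 1) * zetaInv s‖ ≤ X ^ (-κ) * (C * T) := by
    rw [norm_mul]
    refine mul_le_mul ?_ (hC s (by linarith)) (norm_nonneg _) (Real.rpow_nonneg hX0.le _)
    rw [norm_sub_rev, ← ofReal_one, ← ofReal_sub, Complex.norm_real, Real.norm_eq_abs,
      abs_of_nonneg (by linarith [Real.exp_le_one_iff.2 (by simp; positivity : -(1 / X) ≤ 0)])]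
    have h1 : 1 - Real.exp (-(1 / X)) ≤ 1 / X := by
      have := Real.add_one_le_exp (-(1 / X)); linarith
    have h2 : 1 / X ≤ X ^ (-κ) := by
      rw [one_div, ← Real.rpow_neg_one]
      exact Real.rpow_le_rpow_of_exponent_le hX (by linarith)
    linarith
  calc ‖L - zetaInv s‖ = ‖E / (2 * π) + ((Real.exp (-(1 / X)) : ℂ) - 1) * zetaInv s‖ := by rw [hid]
    _ ≤ ‖E / (2 * π)‖ + ‖((Real.exp (-(1 / X)) : ℂ) - 1) * zetaInv s‖ := norm_add_le _ _
    _ ≤ 2 * C * X ^ (-κ) * T * Iκ / (2 * π) + X ^ (-κ) * (C * T) := by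
        refine add_le_add ?_ hexp
        rw [norm_div]
        have : ‖(2 * π : ℂ)‖ = 2 * π := by
          rw [show (2 * π : ℂ) = ((2 * π : ℝ) : ℂ) by push_cast; ring, Complex.norm_real,
            Real.norm_eq_abs, abs_of_pos (by positivity)]
        rw [this]
        exact div_le_div_of_nonneg_right hEn (by positivity)
    _ = (C * Iκ / π + C) * X ^ (-κ) * T := by
        field_simp

/-! ## Truncation and the Dirichlet-polynomial approximation property -/

/-- `‖term (μ e^{-·/X}) w a‖ ≤ e^{-a/X}` for `re w ≥ 0`. [folklore] -/
lemma norm_term_smoothedMoebius_le {X : ℝ} {w : ℂ} (hw : 0 ≤ w.re) (a : ℕ) :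
    ‖LSeries.term (smoothedMoebius X) w a‖ ≤ Real.exp (-(a / X)) := by
  rw [LSeries.norm_term_eq]
  split_ifs with ha
  · positivity
  · have h1 : (1 : ℝ) ≤ (a : ℝ) ^ w.re := Real.one_le_rpow (by exact_mod_cast Nat.one_le_iff_ne_zero.2 ha) hw
    calc ‖smoothedMoebius X a‖ / (a : ℝ) ^ w.re ≤ ‖smoothedMoebius X a‖ :=
          div_le_self (norm_nonneg _) h1
      _ ≤ Real.exp (-(a / X)) := norm_smoothedMoebius_le X a

/-- The tail bound: `‖∑_a μ(a)e^{-a/X}a^{-w} - ∑_{a < N} μ(a)e^{-a/X}a^{-w}‖ ≤ ∑_{a ≥ N} e^{-a/X}`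
(`re w ≥ 0`, `X > 0`). [folklore] -/
lemma norm_LSeries_sub_sum_le {X : ℝ} (hX : 0 < X) {w : ℂ} (hw : 0 ≤ w.re) (N : ℕ) :
    ‖LSeries (smoothedMoebius X) w - ∑ a ∈ Finset.range N, LSeries.term (smoothedMoebius X) w a‖ ≤
      ∑' a : ℕ, Real.exp (-((a + N : ℕ) / X)) := by
  have hg : Summable fun a : ℕ ↦ Real.exp (-(a / X)) := by
    have : (fun a : ℕ ↦ Real.exp (-(a / X))) = fun a : ℕ ↦ Real.exp (-(1 / X)) ^ a := by
      funext a
      rw [← Real.exp_nat_mul]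
      congr 1
      field_simp
    rw [this]
    exact summable_geometric_of_lt_one (Real.exp_pos _).le
      (Real.exp_lt_one_iff.2 (by simp; positivity))
  have hs : Summable fun a : ℕ ↦ LSeries.term (smoothedMoebius X) w a :=
    Summable.of_norm (Summable.of_nonneg_of_le (fun a ↦ norm_nonneg _)
      (fun a ↦ norm_term_smoothedMoebius_le hw a) hg)
  have htail := hs.sum_add_tsum_nat_add N
  rw [LSeries, ← htail, add_sub_cancel_left]
  have hg' : Summable fun a : ℕ ↦ Real.exp (-((a + N : ℕ) / X)) :=
    (summable_nat_add_iff N).2 hg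
  have hle : ∀ a : ℕ, ‖LSeries.term (smoothedMoebius X) w (a + N)‖ ≤ Real.exp (-((a + N : ℕ) / X)) :=
    fun a ↦ norm_term_smoothedMoebius_le hw (a + N)
  have hs' : Summable fun a : ℕ ↦ ‖LSeries.term (smoothedMoebius X) w (a + N)‖ :=
    Summable.of_nonneg_of_le (fun a ↦ norm_nonneg _) hle hg'
  exact (norm_tsum_le_tsum_norm hs').trans (hs'.tsum_le_tsum hle hg')

/-- The tails `∑_{a ≥ n} e^{-a/X}` tend to `0`. [folklore] -/
lemma tendsto_tail_exp (X : ℝ) :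
    Tendsto (fun n : ℕ ↦ ∑' a : ℕ, Real.exp (-((a + n : ℕ) / X))) atTop (𝓝 0) :=
  tendsto_sum_nat_add fun a : ℕ ↦ Real.exp (-(a / X))

/-- The real coefficient vector of the truncated smoothed sum, in the `Fin N` indexing of the
tree's Dirichlet polynomials `Literature.NumberTheory.LFunctions.dirichletPoly` (bases `k+1`):
`d_k = μ(k+1) e^{-(k+1)/X} (k+1)^{-2ε}`, `k < N`, so that
`dirichletPoly d (w) = ∑_{a < N+1} μ(a)e^{-a/X}a^{-(w+2ε)}` (`sum_mbCoeff_mul_cpow`). [folklore] -/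
def mbCoeff (ε X : ℝ) (N : ℕ) (k : Fin N) : ℝ :=
  (ArithmeticFunction.moebius ((k : ℕ) + 1) : ℝ) * Real.exp (-(((k : ℕ) + 1 : ℝ) / X)) *
    ((k : ℕ) + 1 : ℝ) ^ (-(2 * ε))

/-- **The coefficients `mbCoeff` realise the truncated smoothed sum**, shifted by `2ε`:
`∑_{k<N} d_k (k+1)^{-w} = ∑_{a < N+1} μ(a)e^{-a/X}a^{-(w+2ε)}` (the sum estimated in
`norm_LSeries_sub_sum_le` with `N + 1` in place of `N`; the left side is the tree's Dirichlet
polynomial `Literature.RH.dirichletPoly (fun k ↦ (d k : ℂ)) w` of `NymanBeurlingDirichlet.lean`, unfolded).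
[folklore] -/
theorem sum_mbCoeff_mul_cpow (ε X : ℝ) (N : ℕ) (w : ℂ) :
    ∑ k : Fin N, (mbCoeff ε X N k : ℂ) * (((k : ℕ) : ℂ) + 1) ^ (-w) =
      ∑ a ∈ Finset.range (N + 1), LSeries.term (smoothedMoebius X) (w + 2 * ε) a := by
  rw [Finset.sum_range_succ', LSeries.term_zero, add_zero,
    ← Fin.sum_univ_eq_sum_range (fun a ↦ LSeries.term (smoothedMoebius X) (w + 2 * ε) (a + 1)) N]
  refine Finset.sum_congr rfl fun k _ ↦ ?_
  have hk : (0 : ℝ) ≤ (k : ℕ) + 1 := by positivity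
  have hk' : (((k : ℕ) : ℂ) + 1) ≠ 0 := by exact_mod_cast Nat.succ_ne_zero k
  rw [LSeries.term_of_ne_zero (Nat.succ_ne_zero k)]
  simp only [mbCoeff, smoothedMoebius, Nat.succ_eq_add_one]
  push_cast
  rw [Complex.ofReal_cpow hk]
  push_cast
  simp only [div_eq_mul_inv]
  rw [← cpow_neg, neg_add, cpow_add _ _ hk']
  ring

end MellinBarnes

end Literature.NumberTheory.LFunctions

end
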